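import Summits.BirchSwinnertonDyer.Rank1Residual.O5.CharTwistPrimeIsometry
import Summits.BirchSwinnertonDyer.Rank1Residual.O5.CongruenceNumberTwist
import Literature.NumberTheory.EllipticCurves.RootNumberTwistProofs
import Literature.NumberTheory.EllipticCurves.LFunctionSmulProofs
import HarnessLib

/-!
# O5/N10: TWIN for every odd prime — `congruenceNumber (f ⊗ (·/p)) = congruenceNumber f` at level `p² ∣ N`, and `O5.CongruenceNumberTwin` PROVED

HONEST FRAMING (cell `b2b-bsdres`, run/shared/lean/b2b/bsd-rank1-residual/, verbatim in every
file): the goal of the cell is to DELETE the COMBINATION-SHAPED residual classes of the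
Birch–Swinnerton-Dyer formula for ALL analytic-rank `≤ 1` elliptic curves over `ℚ` — assembled
STRICTLY from published theorems — so that the rank-`≤ 1` remainder becomes exactly the
CONSTRUCTION-SHAPED classes, which are TYPED, NOT attempted. This is not "finishing BSD". Lane
CLASS-CLOSURE, team o5; o5-r2 GEN 7 (G7-2)/N2 'TWIN' and cc-typer-5 GEN 7's node
`O5.CongruenceNumberTwin` (`O5/CongruenceNumberTwist.lean`, p291014; `@[conjecture]` "until a kernel
proof"); prover seat `b2b-bsdres-x11b3-p5` (gen. 7, cross-cell pool). THEOREMS ONLY (no definition,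
no named fact, no `sorry`); nothing booked; no RESIDUAL-MAP mark / label / count moved; the OTHER O5
conjecture nodes (R-TW `CongruenceNumberTwistJumpAtNine`, R-FLAT `CongruenceDefectFlatTwinAtNine`,
E-O5-CONG `CongruenceDefectLawAtNine`) are UNTOUCHED and NOT discharged.

## What

* **TWIN, all primes (`PrimeTwist.congruenceNumber_charTwist`).** For a prime `p` with `p² ∣ N`,
  `χ` the primitive quadratic character mod `p`, and EVERY `p`-depleted `f ∈ S_k(Γ₀(N))`
  (`aₙ(f) = 0` for `p ∣ n`; every newform of level `N` is), the ARS congruence number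
  (`#(S_k(Γ₀(N); ℤ)/(ℤg + (ℤg)^⊥))`, [AgasheRibetStein2012] §2.1 (ii)) satisfies
  `congruenceNumber (f ⊗ χ) = congruenceNumber f` — via the Petersson ISOMETRY of the twist
  (`O5/CharTwistPrimeIsometry.lean`): the twist induces a bijection of the two quotients. No newform
  theory, no integrality / non-vanishing hypothesis.
* `PrimeTwist.congruenceNumber_twin_prime`: for `W' ≅ W ⊗ χ_{p*}` (`p` odd) and parametrisation data
  `D`, `D'` at the same level `N` with `p² ∣ N`: `congruenceNumber D'.f = congruenceNumber D.f`
  (`D'.f = D.f ⊗ (·/p)` coefficientwise: `LFunction_quadraticTwist_pStar_apply` + `LFunction_smul` off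
  `p`, newform depletion at `p`).
* **`O5.congruenceNumberTwin_holds : CongruenceNumberTwin`** — cc-typer-5's `@[conjecture]` node
  (o5-r2's THEOREM-CANDIDATE TWIN, ALL odd `p`) is now a THEOREM of the tree; its corollaries
  `congDefect_twin_eq_add_one` / `padicValNat_deg_lt_congruenceNumber_of_twin`
  (`O5/CongruenceNumberTwist.lean` §2) become unconditional in `hT` by applying them to
  `congruenceNumberTwin_holds`. The residual conjectural content of E-O5-CONG is R-TW ∧ R-FLAT
  (o5-r2 GEN 7 (G7-3)), untouched here.

References: [AgasheRibetStein2012] §2.1; [Shimura1971] Prop. 3.64; [DiamondShurman2005] Prop. 5.5.2(a);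
[AtkinLehner1970] Thm. 3; cell files `HOME/b2b-bsdres-o5-r2/gen7/{O5-GEN7.md, TWIN-PROOF.md}`.
-/

noncomputable section

open scoped MatrixGroups ModularForm ComplexConjugate

open Matrix.SpecialLinearGroup Matrix.GeneralLinearGroup UpperHalfPlane Complex
  CongruenceSubgroup Literature.NumberTheory.EllipticCurves.ModularForms
  Literature.NumberTheory.Automorphic WeierstrassCurve

namespace Summit.BirchSwinnertonDyer.Rank1Residual.O5

namespace PrimeTwist

variable {N p : ℕ} [NeZero N] [hp : Fact p.Prime] {k : ℤ} (hpN : p ^ 2 ∣ N)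
  {χ : DirichletCharacter ℂ p} (hχ : χ.IsQuadratic)

/-! ### §1 Transport of `ℤf + (ℤf)^⊥` under the twist -/

/-- `R` maps `ℤf + (ℤf)^⊥` into `ℤ Rf + (ℤ Rf)^⊥` for a `p`-depleted `f`. [cite: AgasheRibetStein2012, §2.1] -/
theorem charTwist_mem_sup (hprim : χ.IsPrimitive) {f : CuspForm (Gamma0 N) k}
    (hf : ∀ n, p ∣ n → cuspCoeff f n = 0) {x : CuspForm (Gamma0 N) k}
    (hx : x ∈ (ℤ ∙ f) ⊔ integralOrthogonal0 f) :
    charTwist N dvd_rfl hpN hχ x ∈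
      (ℤ ∙ charTwist N dvd_rfl hpN hχ f) ⊔ integralOrthogonal0 (charTwist N dvd_rfl hpN hχ f) := by
  obtain ⟨a, ha, b, hb, rfl⟩ := Submodule.mem_sup.mp hx
  obtain ⟨z, rfl⟩ := Submodule.mem_span_singleton.mp ha
  rw [mem_integralOrthogonal0] at hb
  rw [charTwist_add hpN hχ hprim, charTwist_zsmul hpN hχ hprim]
  refine Submodule.add_mem _ (Submodule.mem_sup_left (Submodule.mem_span_singleton.mpr ⟨z, rfl⟩))
    (Submodule.mem_sup_right ?_)
  rw [mem_integralOrthogonal0]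
  exact ⟨charTwist_mem_integralCuspForms0 hpN hχ hprim hb.1,
    peterssonProduct_charTwist_charTwist_eq_zero hpN hχ hprim hf hb.2⟩

/-- `x − R(R x) ∈ (ℤf)^⊥ ⊆ ℤf + (ℤf)^⊥` for a `p`-depleted `f` and an integral `x`.
[cite: AgasheRibetStein2012, §2.1] -/
theorem sub_charTwist_charTwist_mem_sup (hprim : χ.IsPrimitive) {f : CuspForm (Gamma0 N) k}
    (hf : ∀ n, p ∣ n → cuspCoeff f n = 0) {x : CuspForm (Gamma0 N) k}
    (hx : x ∈ integralCuspForms0 N k) :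
    x - charTwist N dvd_rfl hpN hχ (charTwist N dvd_rfl hpN hχ x) ∈ (ℤ ∙ f) ⊔ integralOrthogonal0 f := by
  refine Submodule.mem_sup_right ?_
  rw [mem_integralOrthogonal0]
  exact ⟨Submodule.sub_mem _ hx
      (charTwist_mem_integralCuspForms0 hpN hχ hprim (charTwist_mem_integralCuspForms0 hpN hχ hprim hx)),
    peterssonProduct_sub_charTwist_charTwist_eq_zero hpN hχ hprim hf x⟩

/-! ### §2 TWIN for every prime `p` with `p² ∣ N` -/

/-- **TWIN — the congruence number is invariant under the twist by the quadratic character mod `p`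
at level `p² ∣ N`:** for every `p`-depleted `f ∈ S_k(Γ₀(N))`,
`congruenceNumber (f ⊗ χ) = congruenceNumber f` (ARS 2012 §2.1 (ii)). The twist induces mutually
inverse bijections of the two quotients (`R² ≡ id` modulo `(ℤf)^⊥`, `R(R f) = f`); no newform theory.
[cite: AgasheRibetStein2012, §2.1] [cite: Shimura1971, Prop. 3.64] -/
theorem congruenceNumber_charTwist (hprim : χ.IsPrimitive) {f : CuspForm (Gamma0 N) k}
    (hf : ∀ n, p ∣ n → cuspCoeff f n = 0) :
    congruenceNumber (charTwist N dvd_rfl hpN hχ f) = congruenceNumber f := by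
  set S := integralCuspForms0 N k with hS
  have hRf : ∀ n, p ∣ n → cuspCoeff (charTwist N dvd_rfl hpN hχ f) n = 0 :=
    fun n hn ↦ cuspCoeff_charTwist_eq_zero_of_dvd hpN hχ hprim f hn
  let φ : S →ₗ[ℤ] S :=
    { toFun := fun x ↦ ⟨charTwist N dvd_rfl hpN hχ x, charTwist_mem_integralCuspForms0 hpN hχ hprim x.2⟩
      map_add' := fun x y ↦ Subtype.ext (charTwist_add hpN hχ hprim (x : CuspForm (Gamma0 N) k) y)
      map_smul' := fun z x ↦ Subtype.ext (charTwist_zsmul hpN hχ hprim z (x : CuspForm (Gamma0 N) k)) }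
  have hφ : ∀ x : S, ((φ x : S) : CuspForm (Gamma0 N) k) = charTwist N dvd_rfl hpN hχ x := fun _ ↦ rfl
  set Hf : Submodule ℤ S := ((ℤ ∙ f) ⊔ integralOrthogonal0 f).comap S.subtype with hHf
  set Hg : Submodule ℤ S := ((ℤ ∙ charTwist N dvd_rfl hpN hχ f) ⊔
    integralOrthogonal0 (charTwist N dvd_rfl hpN hχ f)).comap S.subtype with hHg
  have hle : Hf ≤ Hg.comap φ := by
    intro x hx
    rw [Submodule.mem_comap, hHg, Submodule.mem_comap, Submodule.subtype_apply, hφ]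
    rw [hHf, Submodule.mem_comap, Submodule.subtype_apply] at hx
    exact charTwist_mem_sup hpN hχ hprim hf hx
  let ψ : (S ⧸ Hf) →ₗ[ℤ] (S ⧸ Hg) := Hf.mapQ Hg φ hle
  have hψ : ∀ x : S, ψ (Submodule.Quotient.mk x) = Submodule.Quotient.mk (φ x) := fun _ ↦ rfl
  have hinj : Function.Injective ψ := by
    rw [← LinearMap.ker_eq_bot, LinearMap.ker_eq_bot']
    intro q hq
    obtain ⟨x, rfl⟩ := Submodule.Quotient.mk_surjective Hf q
    rw [hψ, Submodule.Quotient.mk_eq_zero, hHg, Submodule.mem_comap, Submodule.subtype_apply, hφ] at hq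
    rw [Submodule.Quotient.mk_eq_zero, hHf, Submodule.mem_comap, Submodule.subtype_apply]
    have h2 := charTwist_mem_sup hpN hχ hprim hRf hq
    rw [charTwist_charTwist hpN hχ hprim hf] at h2
    have h3 := sub_charTwist_charTwist_mem_sup hpN hχ hprim hf x.2
    simpa using Submodule.add_mem _ h3 h2
  have hsurj : Function.Surjective ψ := by
    intro q
    obtain ⟨y, rfl⟩ := Submodule.Quotient.mk_surjective Hg q
    refine ⟨Submodule.Quotient.mk (φ y), ?_⟩
    rw [hψ, Submodule.Quotient.eq, hHg, Submodule.mem_comap, Submodule.subtype_apply]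
    have h' := sub_charTwist_charTwist_mem_sup hpN hχ hprim hRf y.2
    have := Submodule.neg_mem _ h'
    simpa [hφ, neg_sub] using this
  rw [congruenceNumber_def, congruenceNumber_def]
  exact (Nat.card_congr (Equiv.ofBijective ψ ⟨hinj, hsurj⟩)).symm

/-! ### §3 Newforms of level `p² ∣ N` are `p`-depleted; TWIN for newforms and for twin curves -/

/-- A newform `f` of level `N` with `p² ∣ N` has `aₙ(f) = 0` for all `p ∣ n` (`a_p = 0` and
`a_{pm} = a_p aₘ` for `p ∣ N`). [cite: AtkinLehner1970, Thm. 3] -/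
theorem cuspCoeff_eq_zero_of_prime_dvd_of_isNewform0 (hpN : p ^ 2 ∣ N) {f : CuspForm (Gamma0 N) k}
    (hf : IsNewform0 f) {n : ℕ} (hn : p ∣ n) : cuspCoeff f n = 0 := by
  obtain ⟨m, rfl⟩ := hn
  have hpN1 : p ∣ N := (dvd_pow_self p two_ne_zero).trans hpN
  rw [hf.cuspCoeff_prime_mul hp.out m, if_pos hpN1, sub_zero,
    hf.cuspCoeff_eq_zero_of_sq_dvd hp.out hpN, zero_mul]

/-- **TWIN for newforms** of level `N`, `p² ∣ N`. [cite: AgasheRibetStein2012, §2.1] -/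
theorem congruenceNumber_charTwist_of_isNewform0 (hprim : χ.IsPrimitive) {f : CuspForm (Gamma0 N) k}
    (hf : IsNewform0 f) : congruenceNumber (charTwist N dvd_rfl hpN hχ f) = congruenceNumber f :=
  congruenceNumber_charTwist hpN hχ hprim fun _ hn ↦ cuspCoeff_eq_zero_of_prime_dvd_of_isNewform0 hpN hf hn

/-- **TWIN for parametrisation data of a `p*`-twin pair** (`p` odd, `p² ∣ N` = the common level):
`congruenceNumber D'.f = congruenceNumber D.f` — no conductor / minimality binders needed.
`D'.f = D.f ⊗ (·/p)` coefficientwise (`LFunction_quadraticTwist_pStar_apply`, `LFunction_smul`,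
`quadraticChar_ringHomComp_apply_natCast`; newform depletion at `p ∣ n`).
[cite: AgasheRibetStein2012, §2.1] [cite: Shimura1971, Prop. 3.64] -/
theorem congruenceNumber_twin_prime (hpN : p ^ 2 ∣ N) (hp2 : p ≠ 2) {W W' : WeierstrassCurve ℚ}
    [W.IsElliptic]
    [W'.IsElliptic] (C : VariableChange ℚ) (hC : C • W.quadraticTwist (pStarRat p) = W')
    (D : ModularParametrizationData W N) (D' : ModularParametrizationData W' N) :
    congruenceNumber D'.f = congruenceNumber D.f := by
  set χ' : DirichletCharacter ℂ p := (quadraticChar (ZMod p)).ringHomComp (Int.castRingHom ℂ)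
    with hχdef
  have hχq : χ'.IsQuadratic := isQuadratic_quadraticChar_ringHomComp p
  have hprim : χ'.IsPrimitive := isPrimitive_quadraticChar_ringHomComp p hp2
  have hd0 : pStarRat p ≠ 0 := by
    unfold pStarRat
    push_cast
    exact mul_ne_zero (pow_ne_zero _ (by norm_num)) (by exact_mod_cast hp.out.ne_zero)
  haveI : (W.quadraticTwist (pStarRat p)).IsElliptic := W.isElliptic_quadraticTwist hd0
  have hD' : D'.f = charTwist N dvd_rfl hpN hχq D.f := by
    refine eq_of_forall_cuspCoeff_eq_gamma0 fun n ↦ ?_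
    rw [cuspCoeff_charTwist N _ hpN hχq hprim, hχdef, quadraticChar_ringHomComp_apply_natCast]
    by_cases hn : p ∣ n
    · rw [cuspCoeff_eq_zero_of_prime_dvd_of_isNewform0 hpN D'.isNewformOf.1 hn,
        cuspCoeff_eq_zero_of_prime_dvd_of_isNewform0 hpN D.isNewformOf.1 hn, mul_zero]
    · rw [D'.isNewformOf.2 n, D.isNewformOf.2 n, ← hC, WeierstrassCurve.LFunction_smul, pStarRat,
        W.LFunction_quadraticTwist_pStar_apply hp2 hn]
      push_cast
      ring
  rw [hD']
  exact congruenceNumber_charTwist_of_isNewform0 hpN hχq hprim D.isNewformOf.1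

end PrimeTwist

/-! ### §4 The node `O5.CongruenceNumberTwin` is a theorem -/

/-- **`O5.CongruenceNumberTwin` HOLDS** (cc-typer-5's `@[conjecture]` node of o5-r2 GEN 7's TWIN,
ALL odd primes `p`, binders verbatim): for `W' ≅ W ⊗ χ_{p*}` both of conductor `N` with `p² ∣ N`
and parametrisation data `D, D'` at level `N`, `congruenceNumber D'.f = congruenceNumber D.f`. The
conductor and minimality binders are not used (`PrimeTwist.congruenceNumber_twin_prime`). Proof =
the Petersson isometry of the twist on `p`-depleted forms + the induced bijection of the ARS
quotients; NOT the planner's newform-theoretic route. [cite: AgasheRibetStein2012, §2.1]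
[cite: Shimura1971, Prop. 3.64] -/
theorem congruenceNumberTwin_holds : CongruenceNumberTwin := by
  intro p _ hp2 W W' _ _ _ _ C hC N _ D D' _ _ hpN
  exact PrimeTwist.congruenceNumber_twin_prime hpN hp2 C hC D D'

end Summit.BirchSwinnertonDyer.Rank1Residual.O5
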